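import Summits.NavierStokesRegularity.NavierStokesRegularity.Theorems.EulerZoomLiouvillePowerGaugeEulerLiouvilleEnergySaturation
import Summits.NavierStokesRegularity.NavierStokesRegularity.Theorems.EulerZoomLiouvillePowerGaugeEulerLiouvilleSelfSimilarEnergyEquality
import Summits.NavierStokesRegularity.NavierStokesRegularity.Theorems.EulerZoomLiouvillePowerGaugeEulerLiouvilleSelfSimilarEndpointProfilePoisson

/-!
# Energy saturation on rung C1 of the crux `EulerZoomLiouville.PowerGaugeEulerLiouville`, VIII:
# the member-level statements (crux hypotheses verbatim + exact self-similarity)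
# (crux = stmt-NavierStokesRegularity-19832, route №10 `EulerZoomLiouville`, line `birth`)

Seat `ns-ezl-19832-w2` (stub-worker under the crux lead `ns-ezl-19832-p1`), cell ns-regularity-ideate.

COMPOSITION.  For an EXACTLY SELF-SIMILAR member of Seregin's power-gauged ancient Euler class — the crux's
hypotheses verbatim (suitable weak Euler pair on the slab `(−∞,0) × ℝ³`, weak gradient `H`, the three power
gauges `a^{2ρ}A + a^{ρ}E + a^{2ρ}D ≤ c`) with `0 < ρ < 1`, `u(τ) = selfSimilarCollapse γ 0 V τ`,
`p(τ) = selfSimilarCollapsePressure γ 0 P τ`, `γ = 1/(2+ρ)` —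

* `profileData_of_selfSimilar` — the profile-side data bundle: a profile gradient `G` (weak derivative of
  `V` on `ℝ³`), the `A`-growth, the `E`- and `D`-weights (the lineage's dictionary), the weak pressure
  Poisson equation (typeII-p1's `profile_pressure_poisson`) and the PROFILE LOCAL ENERGY EQUALITY for
  every test function (the lead's `selfSimilar_profile_local_energy_equality`);
* `selfSimilar_tendsto_normEnergy` — **the normalised energy `L^{2ρ−1}∫σ(L⁻¹y)|V|²` of the profile
  CONVERGES** as `L → ∞` (every cut-off `σ`);
* `selfSimilar_ae_eq_zero_of_subExtremal` — **NO SUB-EXTREMAL SELF-SIMILAR EULER COLLAPSE IN THE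
  POWER-GAUGED CLASS**: if `liminf_{L→∞} L^{2ρ−1}∫_{B_L}|V|² = 0` then the member vanishes a.e. on the
  slab.  Equivalently, a nontrivial exactly self-similar member has profile energy
  `∫_{B_L}|V|² ≥ c₁ L^{1−2ρ}` (`c₁ > 0`, all large `L`): it SATURATES the `A`-gauge — Bronzi–Shvydkoy 2015
  Thm 1.1 in the weak class, every `ρ ∈ (0,1)`, by the Euler-identity lever (files I–VII);
* `selfSimilar_ae_eq_zero_of_finiteEnergy_profile'` — corollary: for `0 < ρ < 1/2` a member whose profile
  has FINITE ENERGY `∫|V|² < ∞` vanishes (the lead's `…SelfSimilarDeflationMember` without the `L³`/`L^{3/2}`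
  profile hypotheses).

WHAT THIS IS NOT: not NS regularity, not the crux `PowerGaugeEulerLiouville` (item stmt-19832 stays open:
`stub_energeticPast` is crux-sized), not rung C1 — the generic in-window candidate `|V| ∼ |y|^{−(1+ρ)}` has
`N_∞ > 0`; this closes the SUB-EXTREMAL stratum of rung C1 and shows every surviving self-similar candidate
must carry exactly extremal energy growth. `--supports` stmt-19832. [folklore; cf. BronziShvydkoy2015 Thm 1.1]
-/

noncomputable section

set_option linter.dupNamespace false

open MeasureTheory Set Filter Topology Metric Function TopologicalSpace
open scoped ENNReal NNReal RealInnerProductSpace ContDiff Laplacian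

namespace Summit.NavierStokesRegularity.NavierStokesRegularity.Theorems.PowerGaugeEulerLiouville

open Literature.Analysis Literature.Analysis.FunctionSpaces Literature.Analysis.FluidPDE

namespace EnergySaturation

/-- `P ∈ L¹_loc` from the `D`-weight (`0 < ρ < 1`): `P ∈ L^{3/2}(B_L)` for every ball. [folklore] -/
theorem locallyIntegrable_pressure_of_weight {ρ : ℝ} (hρ1 : ρ < 1) {P : EuclideanSpace ℝ (Fin 3) → ℝ}
    (hPm : AEStronglyMeasurable P volume) {C : ℝ≥0∞} (hC : C ≠ ⊤)
    (hD : ∫⁻ y, ‖P y‖ₑ ^ (3 / 2 : ℝ) * ENNReal.ofReal (‖y‖ ^ (2 * ρ - 2)) ≤ C) :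
    LocallyIntegrable P volume := by
  have hball : ∀ L : ℝ, 0 < L → IntegrableOn P (ball (0 : EuclideanSpace ℝ (Fin 3)) L) volume := by
    intro L hL
    haveI : IsFiniteMeasure (volume.restrict (ball (0 : EuclideanSpace ℝ (Fin 3)) L)) :=
      ⟨by rw [Measure.restrict_apply_univ]; exact measure_ball_lt_top⟩
    have hlt : ∫⁻ y in ball (0 : EuclideanSpace ℝ (Fin 3)) L, ‖P y‖ₑ ^ (3 / 2 : ℝ) < ⊤ :=
      lt_of_le_of_lt (lintegral_ball_pressure_le_of_weight hρ1 hD hL)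
        (ENNReal.mul_lt_top ENNReal.ofReal_lt_top hC.lt_top)
    have h32 : (3 / 2 : ℝ≥0∞).toReal = 3 / 2 := by rw [ENNReal.toReal_div]; norm_num
    have hmem : MemLp P (3 / 2) (volume.restrict (ball (0 : EuclideanSpace ℝ (Fin 3)) L)) := by
      refine ⟨hPm.restrict, ?_⟩
      rw [eLpNorm_lt_top_iff_lintegral_rpow_enorm_lt_top (by norm_num)
        (ENNReal.div_lt_top ENNReal.ofNat_ne_top two_ne_zero).ne, h32]
      exact hlt
    have h1le : (1 : ℝ≥0∞) ≤ 3 / 2 := by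
      rw [ENNReal.le_div_iff_mul_le (Or.inl two_ne_zero) (Or.inl ENNReal.ofNat_ne_top)]; norm_num
    exact hmem.integrable h1le
  intro x
  refine ⟨ball 0 (‖x‖ + 1), isOpen_ball.mem_nhds (by rw [mem_ball, dist_zero_right]; linarith), ?_⟩
  exact hball (‖x‖ + 1) (by positivity)

/-- **The profile-side data of an exactly self-similar member** (crux hypotheses verbatim + exact
self-similarity, `0 < ρ < 1`): a profile gradient `G` with the `A`-growth, the `E`- and `D`-weights, the
weak pressure Poisson equation and the profile local energy equality for every test function — the
lineage's dictionary, typeII-p1's `profile_pressure_poisson` and the lead's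
`selfSimilar_profile_local_energy_equality`, bundled. [folklore] -/
theorem profileData_of_selfSimilar {ρ : ℝ} (hρ : 0 < ρ) (hρ1 : ρ < 1)
    {u : ℝ → EuclideanSpace ℝ (Fin 3) → EuclideanSpace ℝ (Fin 3)} {p : ℝ → EuclideanSpace ℝ (Fin 3) → ℝ}
    {H : ℝ → EuclideanSpace ℝ (Fin 3) → EuclideanSpace ℝ (Fin 3) →L[ℝ] EuclideanSpace ℝ (Fin 3)} {c : ℝ≥0}
    (hsw : IsSuitableWeakSolutionOn (slab (EuclideanSpace ℝ (Fin 3)) (Iio 0) isOpen_Iio) 0 0 u p)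
    (hH : HasWeakSpatialGradientOn (slab (EuclideanSpace ℝ (Fin 3)) (Iio 0) isOpen_Iio) u H)
    (hgauge : ∀ a : ℝ, 0 < a →
      ENNReal.ofReal (a ^ (2 * ρ)) * cknA a (0 : ℝ × EuclideanSpace ℝ (Fin 3)) u +
          ENNReal.ofReal (a ^ ρ) * cknE a (0 : ℝ × EuclideanSpace ℝ (Fin 3)) H +
        ENNReal.ofReal (a ^ (2 * ρ)) * cknD a (0 : ℝ × EuclideanSpace ℝ (Fin 3)) p ≤ (c : ℝ≥0∞))
    {V : EuclideanSpace ℝ (Fin 3) → EuclideanSpace ℝ (Fin 3)} {P : EuclideanSpace ℝ (Fin 3) → ℝ}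
    (hu : ∀ τ : ℝ, τ < 0 → u τ = selfSimilarCollapse (1 / (2 + ρ)) 0 V τ)
    (hp : ∀ τ : ℝ, τ < 0 → p τ = selfSimilarCollapsePressure (1 / (2 + ρ)) 0 P τ) :
    ∃ G : EuclideanSpace ℝ (Fin 3) → EuclideanSpace ℝ (Fin 3) →L[ℝ] EuclideanSpace ℝ (Fin 3),
      AEStronglyMeasurable (uncurry u)
          (volume.restrict (Iio (0 : ℝ) ×ˢ (univ : Set (EuclideanSpace ℝ (Fin 3))))) ∧
      AEStronglyMeasurable V volume ∧ AEStronglyMeasurable P volume ∧ AEStronglyMeasurable G volume ∧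
      HasWeakFDerivOn (⊤ : Opens (EuclideanSpace ℝ (Fin 3))) volume V G ∧
      (∀ L : ℝ, 0 < L → ∫⁻ y in ball (0 : EuclideanSpace ℝ (Fin 3)) L, ‖V y‖ₑ ^ 2 ≤
        (c : ℝ≥0∞) * ENNReal.ofReal (L ^ (1 - 2 * ρ))) ∧
      (∫⁻ y, ENNReal.ofReal (frobeniusNormSq (G y)) * ENNReal.ofReal (‖y‖ ^ (ρ - 1)) ≤
        ENNReal.ofReal ((1 - ρ) / (2 + ρ)) * (c : ℝ≥0∞)) ∧
      (∫⁻ y, ‖P y‖ₑ ^ (3 / 2 : ℝ) * ENNReal.ofReal (‖y‖ ^ (2 * ρ - 2)) ≤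
        ENNReal.ofReal ((2 - 2 * ρ) / (2 + ρ)) * (c : ℝ≥0∞)) ∧
      (∀ θ : EuclideanSpace ℝ (Fin 3) → ℝ, ContDiff ℝ (⊤ : ℕ∞) θ → HasCompactSupport θ →
        ∫ y, P y * (Δ θ) y = -∫ y, fderiv ℝ (fderiv ℝ θ) y (V y) (V y)) ∧
      (∀ θ : EuclideanSpace ℝ (Fin 3) → ℝ, IsTestFunctionOn (⊤ : Opens (EuclideanSpace ℝ (Fin 3))) θ →
        (2 - 5 * (1 / (2 + ρ))) * ∫ x, θ x * ‖V x‖ ^ 2 =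
          (∫ x, (‖V x‖ ^ 2 + 2 * P x) * ⟪V x, gradient θ x⟫) +
            (1 / (2 + ρ)) * ∫ x, ‖V x‖ ^ 2 * ⟪x, gradient θ x⟫) := by
  -- the three gauges separately
  have hA : ∀ a : ℝ, 0 < a → ENNReal.ofReal (a ^ (2 * ρ)) *
      cknA a (0 : ℝ × EuclideanSpace ℝ (Fin 3)) u ≤ (c : ℝ≥0∞) :=
    fun a ha => le_trans (le_trans le_self_add le_self_add) (hgauge a ha)
  have hE : ∀ a : ℝ, 0 < a → ENNReal.ofReal (a ^ ρ) *
      cknE a (0 : ℝ × EuclideanSpace ℝ (Fin 3)) H ≤ (c : ℝ≥0∞) :=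
    fun a ha => le_trans (le_trans le_add_self le_self_add) (hgauge a ha)
  have hD : ∀ a : ℝ, 0 < a → ENNReal.ofReal (a ^ (2 * ρ)) *
      cknD a (0 : ℝ × EuclideanSpace ℝ (Fin 3)) p ≤ (c : ℝ≥0∞) :=
    fun a ha => le_trans le_add_self (hgauge a ha)
  -- measurability of `u`, `p`, `H` on the slab (class)
  have hum : AEStronglyMeasurable (uncurry u)
      (volume.restrict (Iio (0 : ℝ) ×ˢ (univ : Set (EuclideanSpace ℝ (Fin 3))))) := by
    have := hH.locallyIntegrableOn.aestronglyMeasurable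
    simpa [slab] using this
  have hpm : AEStronglyMeasurable (uncurry p)
      (volume.restrict (Iio (0 : ℝ) ×ˢ (univ : Set (EuclideanSpace ℝ (Fin 3))))) := by
    have := hsw.distributional.2.2.1.aestronglyMeasurable
    simpa [slab] using this
  have hHm : AEStronglyMeasurable (uncurry H)
      (volume.restrict (Iio (0 : ℝ) ×ˢ (univ : Set (EuclideanSpace ℝ (Fin 3))))) := by
    have := hH.locallyIntegrableOn_grad.aestronglyMeasurable
    simpa [slab] using this
  have hVm := aestronglyMeasurable_profile hum hu
  have hPm := aestronglyMeasurable_pressureProfile hpm hp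
  -- the profile gradient and the self-similar representative of `H`
  obtain ⟨G, hGm, hVG, hHae⟩ := exists_profileGradient_ae hH hu
  set Hss : ℝ → EuclideanSpace ℝ (Fin 3) → EuclideanSpace ℝ (Fin 3) →L[ℝ] EuclideanSpace ℝ (Fin 3) :=
    fun τ x => (-τ) ^ (-1 : ℝ) • G ((-τ) ^ (-(1 / (2 + ρ))) • x) with hHss
  have hHssm' : AEStronglyMeasurable (uncurry Hss)
      (((volume : Measure ℝ).restrict (Iio (0 : ℝ))).prod (volume : Measure (EuclideanSpace ℝ (Fin 3)))) := by
    have h1 : AEStronglyMeasurable (fun z : ℝ × EuclideanSpace ℝ (Fin 3) => G ((-z.1) ^ (-(1 / (2 + ρ))) • z.2))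
        (((volume : Measure ℝ).restrict (Iio (0 : ℝ))).prod (volume : Measure (EuclideanSpace ℝ (Fin 3)))) :=
      hGm.comp_quasiMeasurePreserving (quasiMeasurePreserving_selfSimilarDilation (1 / (2 + ρ)))
    have h2 : AEStronglyMeasurable (fun z : ℝ × EuclideanSpace ℝ (Fin 3) => (-z.1) ^ (-1 : ℝ))
        (((volume : Measure ℝ).restrict (Iio (0 : ℝ))).prod (volume : Measure (EuclideanSpace ℝ (Fin 3)))) :=
      (measurable_fst.neg.pow_const _).aestronglyMeasurable
    exact h2.smul h1
  have hHm' : AEStronglyMeasurable (uncurry H)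
      (((volume : Measure ℝ).restrict (Iio (0 : ℝ))).prod (volume : Measure (EuclideanSpace ℝ (Fin 3)))) := by
    rw [Measure.volume_eq_prod, ← Measure.prod_restrict, Measure.restrict_univ] at hHm
    exact hHm
  have hprod' : uncurry H =ᵐ[((volume : Measure ℝ).restrict (Iio (0 : ℝ))).prod
      (volume : Measure (EuclideanSpace ℝ (Fin 3)))] uncurry Hss :=
    ae_eq_prod_of_ae_ae_eq hHm' hHssm' hHae
  have hprod : uncurry H =ᵐ[volume.restrict (Iio (0 : ℝ) ×ˢ (univ : Set (EuclideanSpace ℝ (Fin 3))))]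
      uncurry Hss := by
    rw [Measure.volume_eq_prod, ← Measure.prod_restrict, Measure.restrict_univ]
    exact hprod'
  have hHssm : AEStronglyMeasurable (uncurry Hss)
      (volume.restrict (Iio (0 : ℝ) ×ˢ (univ : Set (EuclideanSpace ℝ (Fin 3))))) := by
    rw [Measure.volume_eq_prod, ← Measure.prod_restrict, Measure.restrict_univ]
    exact hHssm'
  -- the `E`-gauge passes to the representative
  have hEss : ∀ a : ℝ, 0 < a → ENNReal.ofReal (a ^ ρ) *
      cknE a (0 : ℝ × EuclideanSpace ℝ (Fin 3)) Hss ≤ (c : ℝ≥0∞) := by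
    intro a ha
    have := cknE_congr_ae_slab hprod a 0
    rw [show ((0 : ℝ), (0 : EuclideanSpace ℝ (Fin 3))) = (0 : ℝ × EuclideanSpace ℝ (Fin 3)) from rfl] at this
    rw [← this]
    exact hE a ha
  -- the profile-side data
  have hgrowth := profile_energy_growth_of_gaugeA hρ hu hA
  have hEprof := profile_gradient_weight_of_gaugeE hρ hρ1 hHssm (fun τ _ => rfl) hEss
  have hDprof := profile_pressure_weight_of_gaugeD hρ hρ1 hpm hp hD
  have hV2 : LocallyIntegrable (fun y => ‖V y‖ ^ 2) volume := locallyIntegrable_norm_sq_of_growth hVm hgrowth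
  have hP1 : LocallyIntegrable P volume :=
    locallyIntegrable_pressure_of_weight hρ1 hPm (ENNReal.mul_ne_top ENNReal.ofReal_ne_top ENNReal.coe_ne_top)
      hDprof
  have hPoisson : ∀ θ : EuclideanSpace ℝ (Fin 3) → ℝ, ContDiff ℝ (⊤ : ℕ∞) θ → HasCompactSupport θ →
      ∫ y, P y * (Δ θ) y = -∫ y, fderiv ℝ (fderiv ℝ θ) y (V y) (V y) :=
    fun θ hθ hθc => profile_pressure_poisson hsw hum hu hp hV2 hP1 hθ hθc
  have hEE := fun (θ : EuclideanSpace ℝ (Fin 3) → ℝ)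
      (hθ : IsTestFunctionOn (⊤ : Opens (EuclideanSpace ℝ (Fin 3))) θ) =>
    selfSimilar_profile_local_energy_equality hρ hρ1 hsw hH hgauge hu hp hθ
  exact ⟨G, hum, hVm, hPm, hGm, hVG, hgrowth, hEprof, hDprof, hPoisson, hEE⟩

/-- **The normalised profile energy of an exactly self-similar member converges** (crux hypotheses
verbatim + exact self-similarity, `0 < ρ < 1`): for every cut-off `σ` with `0 ≤ σ ≤ 1`, `σ = 1` on
`B̄₁`, `σ = 0` off `B₂`, `L^{2ρ−1}∫σ(L⁻¹y)|V|²` has a limit as `L → ∞` (Bronzi–Shvydkoy's two-sided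
energy law in Seregin's weak class). [folklore; cf. BronziShvydkoy2015 Thm 1.1] -/
theorem selfSimilar_tendsto_normEnergy {ρ : ℝ} (hρ : 0 < ρ) (hρ1 : ρ < 1)
    {u : ℝ → EuclideanSpace ℝ (Fin 3) → EuclideanSpace ℝ (Fin 3)} {p : ℝ → EuclideanSpace ℝ (Fin 3) → ℝ}
    {H : ℝ → EuclideanSpace ℝ (Fin 3) → EuclideanSpace ℝ (Fin 3) →L[ℝ] EuclideanSpace ℝ (Fin 3)} {c : ℝ≥0}
    (hsw : IsSuitableWeakSolutionOn (slab (EuclideanSpace ℝ (Fin 3)) (Iio 0) isOpen_Iio) 0 0 u p)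
    (hH : HasWeakSpatialGradientOn (slab (EuclideanSpace ℝ (Fin 3)) (Iio 0) isOpen_Iio) u H)
    (hgauge : ∀ a : ℝ, 0 < a →
      ENNReal.ofReal (a ^ (2 * ρ)) * cknA a (0 : ℝ × EuclideanSpace ℝ (Fin 3)) u +
          ENNReal.ofReal (a ^ ρ) * cknE a (0 : ℝ × EuclideanSpace ℝ (Fin 3)) H +
        ENNReal.ofReal (a ^ (2 * ρ)) * cknD a (0 : ℝ × EuclideanSpace ℝ (Fin 3)) p ≤ (c : ℝ≥0∞))
    {V : EuclideanSpace ℝ (Fin 3) → EuclideanSpace ℝ (Fin 3)} {P : EuclideanSpace ℝ (Fin 3) → ℝ}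
    (hu : ∀ τ : ℝ, τ < 0 → u τ = selfSimilarCollapse (1 / (2 + ρ)) 0 V τ)
    (hp : ∀ τ : ℝ, τ < 0 → p τ = selfSimilarCollapsePressure (1 / (2 + ρ)) 0 P τ)
    {σ : EuclideanSpace ℝ (Fin 3) → ℝ} (hσ : IsTestFunctionOn (⊤ : Opens (EuclideanSpace ℝ (Fin 3))) σ)
    (h0 : ∀ z, 0 ≤ σ z) (h1 : ∀ z, σ z ≤ 1) (hone : ∀ z, ‖z‖ ≤ 1 → σ z = 1)
    (hzero : ∀ z, 2 ≤ ‖z‖ → σ z = 0) :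
    ∃ Ninf : ℝ, Tendsto (fun L : ℝ => L ^ (2 * ρ - 1) * ∫ y, σ (L⁻¹ • y) * ‖V y‖ ^ 2) atTop (𝓝 Ninf) := by
  obtain ⟨G, -, hVm, hPm, hGm, hVG, hA, hE, hD, hPoisson, hEE⟩ :=
    profileData_of_selfSimilar hρ hρ1 hsw hH hgauge hu hp
  exact tendsto_normEnergy hρ hρ1 hσ h0 h1 hone hzero hVm hPm hGm hVG hA hE hD hPoisson hEE

/-- **NO SUB-EXTREMAL EXACTLY SELF-SIMILAR EULER COLLAPSE IN THE POWER-GAUGED CLASS** (crux hypotheses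
verbatim + exact self-similarity, every `0 < ρ < 1`).  If the profile's normalised ball energy is not
bounded below — `∀ ε > 0, ∀ L₀, ∃ L ≥ L₀, L^{2ρ−1}∫_{B_L}|V|² < ε` — the member vanishes a.e. on the
slab.  Contrapositive: a nontrivial exactly self-similar member SATURATES the `A`-gauge,
`∫_{B_L}|V|² ≥ c₁ L^{1−2ρ}` for all large `L` with `c₁ > 0` (Bronzi–Shvydkoy 2015 Thm 1.1 in Seregin's weak
class, via the Euler-identity lever of the crux lead). [folklore; cf. BronziShvydkoy2015 Thm 1.1] -/
theorem selfSimilar_ae_eq_zero_of_subExtremal {ρ : ℝ} (hρ : 0 < ρ) (hρ1 : ρ < 1)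
    {u : ℝ → EuclideanSpace ℝ (Fin 3) → EuclideanSpace ℝ (Fin 3)} {p : ℝ → EuclideanSpace ℝ (Fin 3) → ℝ}
    {H : ℝ → EuclideanSpace ℝ (Fin 3) → EuclideanSpace ℝ (Fin 3) →L[ℝ] EuclideanSpace ℝ (Fin 3)} {c : ℝ≥0}
    (hsw : IsSuitableWeakSolutionOn (slab (EuclideanSpace ℝ (Fin 3)) (Iio 0) isOpen_Iio) 0 0 u p)
    (hH : HasWeakSpatialGradientOn (slab (EuclideanSpace ℝ (Fin 3)) (Iio 0) isOpen_Iio) u H)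
    (hgauge : ∀ a : ℝ, 0 < a →
      ENNReal.ofReal (a ^ (2 * ρ)) * cknA a (0 : ℝ × EuclideanSpace ℝ (Fin 3)) u +
          ENNReal.ofReal (a ^ ρ) * cknE a (0 : ℝ × EuclideanSpace ℝ (Fin 3)) H +
        ENNReal.ofReal (a ^ (2 * ρ)) * cknD a (0 : ℝ × EuclideanSpace ℝ (Fin 3)) p ≤ (c : ℝ≥0∞))
    {V : EuclideanSpace ℝ (Fin 3) → EuclideanSpace ℝ (Fin 3)} {P : EuclideanSpace ℝ (Fin 3) → ℝ}
    (hu : ∀ τ : ℝ, τ < 0 → u τ = selfSimilarCollapse (1 / (2 + ρ)) 0 V τ)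
    (hp : ∀ τ : ℝ, τ < 0 → p τ = selfSimilarCollapsePressure (1 / (2 + ρ)) 0 P τ)
    (hsub : ∀ ε : ℝ, 0 < ε → ∀ L₀ : ℝ, ∃ L : ℝ, L₀ ≤ L ∧
      L ^ (2 * ρ - 1) * ∫ y in ball (0 : EuclideanSpace ℝ (Fin 3)) L, ‖V y‖ ^ 2 < ε) :
    uncurry u =ᵐ[volume.restrict (Iio (0 : ℝ) ×ˢ (univ : Set (EuclideanSpace ℝ (Fin 3))))] 0 := by
  obtain ⟨G, hum, hVm, hPm, hGm, hVG, hA, hE, hD, hPoisson, hEE⟩ :=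
    profileData_of_selfSimilar hρ hρ1 hsw hH hgauge hu hp
  exact selfSimilar_ae_eq_zero_of_profile hum hu
    (ae_eq_zero_of_subExtremal hρ hρ1 hVm hPm hGm hVG hA hE hD hPoisson hEE hsub)

/-- **Corollary: no finite-energy exactly self-similar collapse in the deflation range** (crux
hypotheses verbatim + exact self-similarity, `0 < ρ < 1/2`): if the profile has finite energy
`∫|V|² < ∞`, the member vanishes (then `L^{2ρ−1}∫_{B_L}|V|² ≤ L^{2ρ−1}∫|V|² → 0`).  The lead's
`…SelfSimilarDeflationMember` without the `L³`/`L^{3/2}` profile hypotheses. [folklore] -/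
theorem selfSimilar_ae_eq_zero_of_finiteEnergy_profile' {ρ : ℝ} (hρ : 0 < ρ) (hρ1 : ρ < 1 / 2)
    {u : ℝ → EuclideanSpace ℝ (Fin 3) → EuclideanSpace ℝ (Fin 3)} {p : ℝ → EuclideanSpace ℝ (Fin 3) → ℝ}
    {H : ℝ → EuclideanSpace ℝ (Fin 3) → EuclideanSpace ℝ (Fin 3) →L[ℝ] EuclideanSpace ℝ (Fin 3)} {c : ℝ≥0}
    (hsw : IsSuitableWeakSolutionOn (slab (EuclideanSpace ℝ (Fin 3)) (Iio 0) isOpen_Iio) 0 0 u p)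
    (hH : HasWeakSpatialGradientOn (slab (EuclideanSpace ℝ (Fin 3)) (Iio 0) isOpen_Iio) u H)
    (hgauge : ∀ a : ℝ, 0 < a →
      ENNReal.ofReal (a ^ (2 * ρ)) * cknA a (0 : ℝ × EuclideanSpace ℝ (Fin 3)) u +
          ENNReal.ofReal (a ^ ρ) * cknE a (0 : ℝ × EuclideanSpace ℝ (Fin 3)) H +
        ENNReal.ofReal (a ^ (2 * ρ)) * cknD a (0 : ℝ × EuclideanSpace ℝ (Fin 3)) p ≤ (c : ℝ≥0∞))
    {V : EuclideanSpace ℝ (Fin 3) → EuclideanSpace ℝ (Fin 3)} {P : EuclideanSpace ℝ (Fin 3) → ℝ}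
    (hu : ∀ τ : ℝ, τ < 0 → u τ = selfSimilarCollapse (1 / (2 + ρ)) 0 V τ)
    (hp : ∀ τ : ℝ, τ < 0 → p τ = selfSimilarCollapsePressure (1 / (2 + ρ)) 0 P τ)
    (hfin : Integrable (fun y => ‖V y‖ ^ 2) volume) :
    uncurry u =ᵐ[volume.restrict (Iio (0 : ℝ) ×ˢ (univ : Set (EuclideanSpace ℝ (Fin 3))))] 0 := by
  refine selfSimilar_ae_eq_zero_of_subExtremal hρ (by linarith) hsw hH hgauge hu hp fun ε hε L₀ => ?_
  -- `L^{2ρ−1} ∫|V|² → 0`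
  set E₂ : ℝ := ∫ y, ‖V y‖ ^ 2 with hE₂
  have hE₂0 : 0 ≤ E₂ := integral_nonneg fun y => sq_nonneg _
  have htend : Tendsto (fun L : ℝ => L ^ (2 * ρ - 1) * (E₂ + 1)) atTop (𝓝 (0 * (E₂ + 1))) := by
    refine Tendsto.mul_const _ ?_
    have := tendsto_rpow_neg_atTop (y := 1 - 2 * ρ) (by linarith)
    simpa [show -(1 - 2 * ρ) = 2 * ρ - 1 by ring] using this
  rw [zero_mul] at htend
  obtain ⟨L, hLε, hLge⟩ := ((htend.eventually (gt_mem_nhds hε)).and (eventually_ge_atTop (max L₀ 1))).exists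
  have hL0 : 0 < L := lt_of_lt_of_le one_pos ((le_max_right _ _).trans hLge)
  refine ⟨L, (le_max_left _ _).trans hLge, lt_of_le_of_lt ?_ hLε⟩
  have hball : ∫ y in ball (0 : EuclideanSpace ℝ (Fin 3)) L, ‖V y‖ ^ 2 ≤ E₂ + 1 :=
    (setIntegral_le_integral hfin (Eventually.of_forall fun y => sq_nonneg _)).trans (by linarith)
  exact mul_le_mul_of_nonneg_left hball (Real.rpow_nonneg hL0.le _)

end EnergySaturation

end Summit.NavierStokesRegularity.NavierStokesRegularity.Theorems.PowerGaugeEulerLiouville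

end
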